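import Summits.AtomisticToContinuum.BoseEinsteinCondensation.Theorems.BECInsertionCorrectorCorrectorClosureTailModesAux
import Literature.MathematicalPhysics.QuantumManyBody.WeightedCorrector
import HarnessLib

/-!
# Crux `CorrectorClosure` (stmt-AtomisticToContinuum-12058), line `residue-area-law` —
# stub `stub_firstCorrectorBound`, auxiliary file 2: half-lattice folding and tagged-mode algebra

Supports (does not close) stmt-AtomisticToContinuum-12058, route `BECInsertionCorrector`.
Elementary bookkeeping for the first-corrector bound (theorems only):
* the lexicographic half of the punctured cube `{-K,…,K}³ ∖ {0}` (the first non-zero coordinate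
  is positive; no antipodal pairs) and the folding `∑_{cube} f = f 0 + ∑_{half} (f k + f (-k))`;
* the expansion of a translated real trigonometric polynomial `∑ⱼ R(y - xⱼ)`,
  `R = ∑_{k ∈ B} (αₖ cos(p_k·z) - βₖ sin(p_k·z))` with `α₋ₖ = αₖ`, `β₋ₖ = -βₖ`, into tagged
  modes `N α₀ + ∑_{k ∈ S} (aₖ(X') cos(p_k·y) + bₖ(X') sin(p_k·y))` for any index pair `(B, S)` with
  the folding property;
* the subadditivity `‖g₁ + g₂‖²₋₁ ≤ 2‖g₁‖²₋₁ + 2‖g₂‖²₋₁` of the Kipnis–Varadhan norm and the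
  resulting bound of the mode coefficients by the density-wave norms.
-/

noncomputable section

open MeasureTheory Filter Matrix
open scoped ENNReal NNReal BigOperators

namespace Summit.AtomisticToContinuum.BoseEinsteinCondensation.Theorems.CorrectorClosure.ResidueAreaLaw

open Literature.MathematicalPhysics.QuantumManyBody.BoseGas

variable {N : ℕ} {L : ℝ}

/-! ### The lexicographic half-lattice

The half is cut out of the cube `Finset.Icc (-K) K` by the (decidable) predicate "the first
non-zero coordinate is positive", written inline:
`fun k => 0 < k 0 ∨ (k 0 = 0 ∧ (0 < k 1 ∨ (k 1 = 0 ∧ 0 < k 2)))`. -/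

/-- `k = 0` iff all three coordinates vanish. [folklore] -/
theorem eq_zero_iff_coords (k : Fin 3 → ℤ) : k = 0 ↔ k 0 = 0 ∧ k 1 = 0 ∧ k 2 = 0 := by
  constructor
  · rintro rfl; simp
  · rintro ⟨h0, h1, h2⟩
    funext i
    fin_cases i <;> assumption

/-- Every `k ∈ ℤ³` is `0`, lexicographically positive, or has lexicographically positive negative.
[folklore] -/
theorem lexPos_trichotomy (k : Fin 3 → ℤ) :
    k = 0 ∨ (0 < k 0 ∨ (k 0 = 0 ∧ (0 < k 1 ∨ (k 1 = 0 ∧ 0 < k 2)))) ∨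
      (0 < (-k) 0 ∨ ((-k) 0 = 0 ∧ (0 < (-k) 1 ∨ ((-k) 1 = 0 ∧ 0 < (-k) 2)))) := by
  by_cases h : k = 0
  · exact Or.inl h
  · right
    rw [eq_zero_iff_coords] at h
    simp only [Pi.neg_apply]
    omega

/-- `0` is not lexicographically positive. [folklore] -/
theorem not_lexPos_zero :
    ¬ (0 < (0 : Fin 3 → ℤ) 0 ∨ ((0 : Fin 3 → ℤ) 0 = 0 ∧ (0 < (0 : Fin 3 → ℤ) 1 ∨
      ((0 : Fin 3 → ℤ) 1 = 0 ∧ 0 < (0 : Fin 3 → ℤ) 2)))) := by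
  simp

/-- `k` and `-k` are not both lexicographically positive. [folklore] -/
theorem not_lexPos_neg {k : Fin 3 → ℤ} (h : 0 < k 0 ∨ (k 0 = 0 ∧ (0 < k 1 ∨ (k 1 = 0 ∧ 0 < k 2)))) :
    ¬ (0 < (-k) 0 ∨ ((-k) 0 = 0 ∧ (0 < (-k) 1 ∨ ((-k) 1 = 0 ∧ 0 < (-k) 2)))) := by
  simp only [Pi.neg_apply] at h ⊢
  omega

/-- Membership in the cube `{-K,…,K}³`, coordinatewise. [folklore] -/
theorem mem_cube_iff {K : ℕ} {k : Fin 3 → ℤ} :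
    k ∈ Finset.Icc (-(K : Fin 3 → ℤ)) (K : Fin 3 → ℤ) ↔ ∀ i, -(K : ℤ) ≤ k i ∧ k i ≤ K := by
  simp only [Finset.mem_Icc, Pi.le_def, Pi.neg_apply, Pi.natCast_apply]
  exact ⟨fun h i => ⟨h.1 i, h.2 i⟩, fun h => ⟨fun i => (h i).1, fun i => (h i).2⟩⟩

/-- The cube is symmetric. [folklore] -/
theorem neg_mem_cube {K : ℕ} {k : Fin 3 → ℤ} (h : k ∈ Finset.Icc (-(K : Fin 3 → ℤ)) (K : Fin 3 → ℤ)) :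
    -k ∈ Finset.Icc (-(K : Fin 3 → ℤ)) (K : Fin 3 → ℤ) := by
  rw [mem_cube_iff] at h ⊢
  intro i
  have := h i
  simp only [Pi.neg_apply]
  omega

/-- `0 ∈ cube`. [folklore] -/
theorem zero_mem_cube (K : ℕ) : (0 : Fin 3 → ℤ) ∈ Finset.Icc (-(K : Fin 3 → ℤ)) (K : Fin 3 → ℤ) := by
  rw [mem_cube_iff]; intro i; simp

/-- `0 ∉ half cube`. [folklore] -/
theorem zero_notMem_halfCube (K : ℕ) :
    (0 : Fin 3 → ℤ) ∉ (Finset.Icc (-(K : Fin 3 → ℤ)) (K : Fin 3 → ℤ)).filter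
      (fun k : Fin 3 → ℤ => 0 < k 0 ∨ (k 0 = 0 ∧ (0 < k 1 ∨ (k 1 = 0 ∧ 0 < k 2)))) := by
  simp

/-- The half cube contains no antipodal pair. [folklore] -/
theorem neg_notMem_halfCube {K : ℕ} {k : Fin 3 → ℤ}
    (h : k ∈ (Finset.Icc (-(K : Fin 3 → ℤ)) (K : Fin 3 → ℤ)).filter fun k : Fin 3 → ℤ =>
      0 < k 0 ∨ (k 0 = 0 ∧ (0 < k 1 ∨ (k 1 = 0 ∧ 0 < k 2)))) :
    -k ∉ (Finset.Icc (-(K : Fin 3 → ℤ)) (K : Fin 3 → ℤ)).filter fun k : Fin 3 → ℤ =>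
      0 < k 0 ∨ (k 0 = 0 ∧ (0 < k 1 ∨ (k 1 = 0 ∧ 0 < k 2))) := by
  simp only [Finset.mem_filter] at h ⊢
  exact fun h' => not_lexPos_neg h.2 h'.2

/-- **Folding the cube onto its half**: `∑_{k ∈ cube} f k = f 0 + ∑_{k ∈ half} (f k + f (-k))`.
[folklore] -/
theorem sum_cube_eq_halfCube {M : Type*} [AddCommMonoid M] (K : ℕ) (f : (Fin 3 → ℤ) → M) :
    ∑ k ∈ Finset.Icc (-(K : Fin 3 → ℤ)) (K : Fin 3 → ℤ), f k =
      f 0 + ∑ k ∈ (Finset.Icc (-(K : Fin 3 → ℤ)) (K : Fin 3 → ℤ)).filter (fun k : Fin 3 → ℤ =>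
        0 < k 0 ∨ (k 0 = 0 ∧ (0 < k 1 ∨ (k 1 = 0 ∧ 0 < k 2)))), (f k + f (-k)) := by
  classical
  set B : Finset (Fin 3 → ℤ) := Finset.Icc (-(K : Fin 3 → ℤ)) (K : Fin 3 → ℤ) with hB
  rw [Finset.sum_add_distrib, ← Finset.sum_filter_add_sum_filter_not B fun k : Fin 3 → ℤ =>
    0 < k 0 ∨ (k 0 = 0 ∧ (0 < k 1 ∨ (k 1 = 0 ∧ 0 < k 2)))]
  -- the non-positive part: `{0}` and the negatives of the half cube
  have hsplit := Finset.sum_filter_add_sum_filter_not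
    (B.filter fun k => ¬ (0 < k 0 ∨ (k 0 = 0 ∧ (0 < k 1 ∨ (k 1 = 0 ∧ 0 < k 2))))) (fun k => k = 0) f
  have h0 : (B.filter fun k => ¬ (0 < k 0 ∨ (k 0 = 0 ∧ (0 < k 1 ∨ (k 1 = 0 ∧ 0 < k 2))))).filter
      (fun k => k = 0) = {0} := by
    ext k
    simp only [Finset.mem_filter, Finset.mem_singleton]
    constructor
    · exact fun h => h.2
    · rintro rfl; exact ⟨⟨zero_mem_cube K, not_lexPos_zero⟩, rfl⟩
  have hneg : ∑ k ∈ (B.filter fun k => ¬ (0 < k 0 ∨ (k 0 = 0 ∧ (0 < k 1 ∨ (k 1 = 0 ∧ 0 < k 2))))).filter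
      (fun k => ¬ k = 0), f k = ∑ k ∈ B.filter (fun k : Fin 3 → ℤ =>
        0 < k 0 ∨ (k 0 = 0 ∧ (0 < k 1 ∨ (k 1 = 0 ∧ 0 < k 2)))), f (-k) := by
    symm
    refine Finset.sum_nbij' (fun k => -k) (fun k => -k) ?_ ?_ (fun k _ => neg_neg k)
      (fun k _ => neg_neg k) (fun k _ => rfl)
    · intro k hk
      simp only [Finset.mem_filter] at hk
      simp only [Finset.mem_filter, neg_eq_zero]
      refine ⟨⟨neg_mem_cube hk.1, not_lexPos_neg hk.2⟩, ?_⟩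
      rintro rfl; exact not_lexPos_zero hk.2
    · intro k hk
      simp only [Finset.mem_filter] at hk
      simp only [Finset.mem_filter]
      refine ⟨neg_mem_cube hk.1.1, ?_⟩
      rcases lexPos_trichotomy k with h | h | h
      · exact absurd h hk.2
      · exact absurd h hk.1.2
      · exact h
  rw [h0, Finset.sum_singleton, hneg] at hsplit
  rw [← hsplit]
  abel

/-! ### Phases -/

/-- `p_k·(y - x) = p_k·y - p_k·x`. [folklore] -/
theorem phase_sub' (L : ℝ) (k : Fin 3 → ℤ) (y x : Space) :
    2 * Real.pi / L * ∑ i, (k i : ℝ) * (y - x) i =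
      2 * Real.pi / L * ∑ i, (k i : ℝ) * y i - 2 * Real.pi / L * ∑ i, (k i : ℝ) * x i := by
  rw [← mul_sub, ← Finset.sum_sub_distrib]
  congr 1
  refine Finset.sum_congr rfl fun i _ => ?_
  rw [PiLp.sub_apply, mul_sub]

/-- `p_{-k}·z = -(p_k·z)`. [folklore] -/
theorem phase_neg' (L : ℝ) (k : Fin 3 → ℤ) (z : Space) :
    2 * Real.pi / L * ∑ i, (((-k) i : ℤ) : ℝ) * z i = -(2 * Real.pi / L * ∑ i, (k i : ℝ) * z i) := by
  rw [← mul_neg, ← Finset.sum_neg_distrib]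
  congr 1
  refine Finset.sum_congr rfl fun i _ => ?_
  rw [Pi.neg_apply, Int.cast_neg, neg_mul]

/-- `p_0·z = 0`. [folklore] -/
theorem phase_zero' (L : ℝ) (z : Space) :
    2 * Real.pi / L * ∑ i, (((0 : Fin 3 → ℤ) i : ℤ) : ℝ) * z i = 0 := by
  simp

/-! ### Expansion of a translated real trigonometric polynomial into tagged modes -/

/-- **Tagged-mode expansion.** For real coefficients `α, β` with `α₋ₖ = αₖ`, `β₋ₖ = -βₖ`, an index
pair `(B, S)` with the folding property `∑_{B} f = f 0 + ∑_{S} (f k + f (-k))` (the cube and its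
lexicographic half, `sum_cube_eq_halfCube`) and the real trigonometric polynomial
`R(z) = ∑_{k ∈ B} (αₖ cos(p_k·z) - βₖ sin(p_k·z))`, the bath sum of translates is a tagged-mode sum:
`∑ⱼ R(y - xⱼ) = N α₀ + ∑_{k ∈ S} (aₖ(X') cos(p_k·y) + bₖ(X') sin(p_k·y))` with
`aₖ = 2(αₖ ∑ⱼcos(p_k·xⱼ) + βₖ ∑ⱼ sin(p_k·xⱼ))`, `bₖ = 2(αₖ ∑ⱼ sin(p_k·xⱼ) - βₖ ∑ⱼ cos(p_k·xⱼ))`.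
[folklore] -/
theorem sum_translate_trigPoly_eq_modes (L : ℝ) {B S : Finset (Fin 3 → ℤ)}
    (hfold : ∀ f : (Fin 3 → ℤ) → ℝ, ∑ k ∈ B, f k = f 0 + ∑ k ∈ S, (f k + f (-k)))
    (α β : (Fin 3 → ℤ) → ℝ) (hα : ∀ k, α (-k) = α k) (hβ : ∀ k, β (-k) = -β k) (Z : Config N)
    (y : Space) :
    ∑ j : Fin N, ∑ k ∈ B,
        (α k * Real.cos (2 * Real.pi / L * ∑ i, (k i : ℝ) * (y - Z j) i) -
          β k * Real.sin (2 * Real.pi / L * ∑ i, (k i : ℝ) * (y - Z j) i)) =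
      N * α 0 + ∑ k ∈ S,
        (2 * (α k * ∑ j, Real.cos (2 * Real.pi / L * ∑ i, (k i : ℝ) * Z j i) +
              β k * ∑ j, Real.sin (2 * Real.pi / L * ∑ i, (k i : ℝ) * Z j i)) *
            Real.cos (2 * Real.pi / L * ∑ i, (k i : ℝ) * y i) +
          2 * (α k * ∑ j, Real.sin (2 * Real.pi / L * ∑ i, (k i : ℝ) * Z j i) -
              β k * ∑ j, Real.cos (2 * Real.pi / L * ∑ i, (k i : ℝ) * Z j i)) *
            Real.sin (2 * Real.pi / L * ∑ i, (k i : ℝ) * y i)) := by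
  -- the one-mode term and its symmetry under `k ↦ -k`
  set t : (Fin 3 → ℤ) → Fin N → ℝ := fun k j =>
    α k * Real.cos (2 * Real.pi / L * ∑ i, (k i : ℝ) * (y - Z j) i) -
      β k * Real.sin (2 * Real.pi / L * ∑ i, (k i : ℝ) * (y - Z j) i) with ht
  have htneg : ∀ k j, t (-k) j = t k j := fun k j => by
    simp only [ht, phase_neg', Real.cos_neg, Real.sin_neg, hα, hβ]
    ring
  have ht0 : ∀ j, t 0 j = α 0 := fun j => by
    simp only [ht, phase_zero', Real.cos_zero, Real.sin_zero]
    ring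
  -- the one-mode term expanded: `t k j = cos(p·y)(α cos(p·xⱼ) + β sin(p·xⱼ)) + sin(p·y)(α sin - β cos)`
  have hexp : ∀ k j, t k j =
      Real.cos (2 * Real.pi / L * ∑ i, (k i : ℝ) * y i) *
          (α k * Real.cos (2 * Real.pi / L * ∑ i, (k i : ℝ) * Z j i) +
            β k * Real.sin (2 * Real.pi / L * ∑ i, (k i : ℝ) * Z j i)) +
        Real.sin (2 * Real.pi / L * ∑ i, (k i : ℝ) * y i) *
          (α k * Real.sin (2 * Real.pi / L * ∑ i, (k i : ℝ) * Z j i) -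
            β k * Real.cos (2 * Real.pi / L * ∑ i, (k i : ℝ) * Z j i)) := fun k j => by
    simp only [ht, phase_sub', Real.cos_sub, Real.sin_sub]
    ring
  calc ∑ j : Fin N, ∑ k ∈ B, t k j
      = ∑ k ∈ B, ∑ j : Fin N, t k j := Finset.sum_comm
    _ = ∑ j : Fin N, t 0 j + ∑ k ∈ S, (∑ j : Fin N, t k j + ∑ j : Fin N, t (-k) j) := hfold _
    _ = N * α 0 + ∑ k ∈ S, 2 * ∑ j : Fin N, t k j := by
        congr 1
        · simp only [ht0, Finset.sum_const, Finset.card_univ, Fintype.card_fin, nsmul_eq_mul]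
        · refine Finset.sum_congr rfl fun k _ => ?_
          simp only [htneg]
          ring
    _ = _ := by
        congr 1
        refine Finset.sum_congr rfl fun k _ => ?_
        have h1 : ∑ j : Fin N, t k j =
            Real.cos (2 * Real.pi / L * ∑ i, (k i : ℝ) * y i) *
                (α k * ∑ j, Real.cos (2 * Real.pi / L * ∑ i, (k i : ℝ) * Z j i) +
                  β k * ∑ j, Real.sin (2 * Real.pi / L * ∑ i, (k i : ℝ) * Z j i)) +
              Real.sin (2 * Real.pi / L * ∑ i, (k i : ℝ) * y i) *
                (α k * ∑ j, Real.sin (2 * Real.pi / L * ∑ i, (k i : ℝ) * Z j i) -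
                  β k * ∑ j, Real.cos (2 * Real.pi / L * ∑ i, (k i : ℝ) * Z j i)) := by
          rw [Finset.sum_congr rfl fun j _ => hexp k j, Finset.sum_add_distrib, ← Finset.mul_sum,
            ← Finset.mul_sum, Finset.sum_add_distrib, Finset.sum_sub_distrib, ← Finset.mul_sum,
            ← Finset.mul_sum, ← Finset.mul_sum, ← Finset.mul_sum]
        rw [h1]
        ring

/-! ### Subadditivity of the Kipnis–Varadhan norm -/

/-- **Subadditivity of `‖·‖²₋₁`**: `‖g₁ + g₂‖²₋₁ ≤ 2‖g₁‖²₋₁ + 2‖g₂‖²₋₁` for continuous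
observables and a continuous weight (test each term of the supremum against `φ/2`). [folklore] -/
theorem hMinusOneSqW_add_le (L : ℝ) {F g₁ g₂ : Config N → ℝ} (hF : Continuous F)
    (hg₁ : Continuous g₁) (hg₂ : Continuous g₂) :
    hMinusOneSqW L F (g₁ + g₂) ≤ 2 * hMinusOneSqW L F g₁ + 2 * hMinusOneSqW L F g₂ := by
  unfold hMinusOneSqW
  refine iSup₂_le fun φ hφ => ?_
  have hφc : Continuous φ := hφ.continuous
  have hint : ∀ {g : Config N → ℝ}, Continuous g →
      Integrable (fun X => g X * φ X * F X ^ 2) (volume.restrict (cellN N L)) := fun hg =>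
    integrableOn_cellN ((hg.mul hφc).mul (hF.pow 2)) L
  have hsum : ∫ X in cellN N L, (g₁ + g₂) X * φ X * F X ^ 2 =
      (∫ X in cellN N L, g₁ X * φ X * F X ^ 2) + ∫ X in cellN N L, g₂ X * φ X * F X ^ 2 := by
    rw [← integral_add (hint hg₁) (hint hg₂)]
    refine integral_congr_ae (Eventually.of_forall fun X => ?_)
    simp only [Pi.add_apply]
    ring
  -- each observable tested against `φ/2`
  have hhalf : ∀ g : Config N → ℝ,
      ENNReal.ofReal (2 * (∫ X in cellN N L, g X * φ X * F X ^ 2) -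
        (1 / 2) * dirichletFormW L F φ φ) ≤
        2 * ⨆ (ψ : Config N → ℝ) (_ : IsPeriodicTest L ψ),
          ENNReal.ofReal (2 * (∫ X in cellN N L, g X * ψ X * F X ^ 2) - dirichletFormW L F ψ ψ) := by
    intro g
    have h := le_hMinusOneSqW L F g (hφ.smul (1 / 2))
    rw [integral_mul_smul_mul_sq, dirichletFormW_smul_left, dirichletFormW_smul_right] at h
    unfold hMinusOneSqW at h
    have e : 2 * (∫ X in cellN N L, g X * φ X * F X ^ 2) - 1 / 2 * dirichletFormW L F φ φ =
        2 * (2 * (1 / 2 * ∫ X in cellN N L, g X * φ X * F X ^ 2) -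
          1 / 2 * (1 / 2 * dirichletFormW L F φ φ)) := by ring
    rw [e, ENNReal.ofReal_mul zero_le_two, ENNReal.ofReal_ofNat]
    gcongr
  calc ENNReal.ofReal (2 * (∫ X in cellN N L, (g₁ + g₂) X * φ X * F X ^ 2) - dirichletFormW L F φ φ)
      = ENNReal.ofReal ((2 * (∫ X in cellN N L, g₁ X * φ X * F X ^ 2) -
            (1 / 2) * dirichletFormW L F φ φ) +
          (2 * (∫ X in cellN N L, g₂ X * φ X * F X ^ 2) - (1 / 2) * dirichletFormW L F φ φ)) := by
        rw [hsum]; congr 1; ring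
    _ ≤ ENNReal.ofReal (2 * (∫ X in cellN N L, g₁ X * φ X * F X ^ 2) -
            (1 / 2) * dirichletFormW L F φ φ) +
          ENNReal.ofReal (2 * (∫ X in cellN N L, g₂ X * φ X * F X ^ 2) -
            (1 / 2) * dirichletFormW L F φ φ) := ENNReal.ofReal_add_le
    _ ≤ _ := add_le_add (hhalf g₁) (hhalf g₂)

/-- **Mode coefficients are bounded by the density-wave norms.** If the cosine and sine density
waves `C, S` of one frequency have `‖C‖²₋₁, ‖S‖²₋₁ ≤ M`, then for real `α, β` the combinations
`2(αC + βS)` and `2(αS - βC)` have `‖·‖²₋₁ ≤ 8(α² + β²)M`. [folklore] -/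
theorem hMinusOneSqW_modeCoeff_le (L : ℝ) {Θ C S : Config N → ℝ} (hΘ : Continuous Θ)
    (hC : Continuous C) (hS : Continuous S) {M : ℝ} (hM : 0 ≤ M)
    (hCM : hMinusOneSqW L Θ C ≤ ENNReal.ofReal M) (hSM : hMinusOneSqW L Θ S ≤ ENNReal.ofReal M)
    (α β : ℝ) :
    hMinusOneSqW L Θ (fun Z => 2 * (α * C Z + β * S Z)) ≤
        ENNReal.ofReal (8 * (α ^ 2 + β ^ 2) * M) ∧
      hMinusOneSqW L Θ (fun Z => 2 * (α * S Z - β * C Z)) ≤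
        ENNReal.ofReal (8 * (α ^ 2 + β ^ 2) * M) := by
  -- the generic estimate for `c₁ • g₁ + c₂ • g₂`
  have key : ∀ (c₁ c₂ : ℝ) {g₁ g₂ : Config N → ℝ}, Continuous g₁ → Continuous g₂ →
      hMinusOneSqW L Θ g₁ ≤ ENNReal.ofReal M → hMinusOneSqW L Θ g₂ ≤ ENNReal.ofReal M →
      hMinusOneSqW L Θ (c₁ • g₁ + c₂ • g₂) ≤ ENNReal.ofReal (2 * (c₁ ^ 2 + c₂ ^ 2) * M) := by
    intro c₁ c₂ g₁ g₂ hg₁ hg₂ h₁ h₂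
    calc hMinusOneSqW L Θ (c₁ • g₁ + c₂ • g₂)
        ≤ 2 * hMinusOneSqW L Θ (c₁ • g₁) + 2 * hMinusOneSqW L Θ (c₂ • g₂) :=
          hMinusOneSqW_add_le L hΘ (hg₁.const_smul c₁) (hg₂.const_smul c₂)
      _ = 2 * (ENNReal.ofReal (c₁ ^ 2) * hMinusOneSqW L Θ g₁) +
            2 * (ENNReal.ofReal (c₂ ^ 2) * hMinusOneSqW L Θ g₂) := by
          rw [hMinusOneSqW_smul, hMinusOneSqW_smul]
      _ ≤ 2 * (ENNReal.ofReal (c₁ ^ 2) * ENNReal.ofReal M) +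
            2 * (ENNReal.ofReal (c₂ ^ 2) * ENNReal.ofReal M) := by gcongr
      _ = ENNReal.ofReal (2 * (c₁ ^ 2 + c₂ ^ 2) * M) := by
          rw [← ENNReal.ofReal_mul (sq_nonneg _), ← ENNReal.ofReal_mul (sq_nonneg _),
            ← ENNReal.ofReal_ofNat, ← ENNReal.ofReal_mul zero_le_two,
            ← ENNReal.ofReal_mul zero_le_two, ← ENNReal.ofReal_add (by positivity) (by positivity)]
          congr 1; ring
  have e8 : ∀ c₁ c₂ : ℝ, c₁ ^ 2 + c₂ ^ 2 = 4 * (α ^ 2 + β ^ 2) →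
      2 * (c₁ ^ 2 + c₂ ^ 2) * M = 8 * (α ^ 2 + β ^ 2) * M := fun c₁ c₂ h => by rw [h]; ring
  constructor
  · have hfun : (fun Z => 2 * (α * C Z + β * S Z)) = (2 * α) • C + (2 * β) • S := by
      funext Z; simp only [Pi.add_apply, Pi.smul_apply, smul_eq_mul]; ring
    rw [hfun, ← e8 (2 * α) (2 * β) (by ring)]
    exact key _ _ hC hS hCM hSM
  · have hfun : (fun Z => 2 * (α * S Z - β * C Z)) = (2 * α) • S + (-(2 * β)) • C := by
      funext Z; simp only [Pi.add_apply, Pi.smul_apply, smul_eq_mul]; ring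
    rw [hfun, ← e8 (2 * α) (-(2 * β)) (by ring)]
    exact key _ _ hS hC hSM hCM

end Summit.AtomisticToContinuum.BoseEinsteinCondensation.Theorems.CorrectorClosure.ResidueAreaLaw

end
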